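import Summits.QuantumFields.YangMills.Theorems.ConvexGribovBodyBrascampLiebVacuumSCFloorCentralInvolutionsOrbit

/-!
# Stub `stub_cubeOrbit` of the line `SketchIdeator1` for the crux `BrascampLiebVacuumSC`
# (stmt-QuantumFields-16404, route `ConvexGribovBody`)

The gauge-orbit infimum of the anti-Hermitian mass on an embedded `n × n × n` cube.

Cube sites are `x : Fin 3 → Fin n`; the link `(x, j)` is *valid* when `x j + 1 < n`, and then it
goes from `x` to `Function.update x j ⟨x j + 1, _⟩`. A cube gauge `k : (Fin 3 → Fin n) → G` acts
on the link value `u x j` by `k x * u x j * (k (target))⁻¹`, and the anti-Hermitian mass of a link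
value `v` is `‖½(ρ(v) − ρ(v)ᴴ)‖²_F` (`froSq`). We construct

`Q_n(u) = inf_k Σ_{valid (x, j)} ‖½(ρ(v) − ρ(v)ᴴ)‖²_F`, `v = k(x) u(x,j) k(x + e_j)⁻¹`,

and prove: continuity (Berge: infimum of a jointly continuous function over the compact
`G^{cube}`), `0 ≤ Q_n ≤ 3 n³ N` (each term is at most `N`, there are `3 n³` pairs `(x, j)`),
dependence only on the valid entries of `u`, the any-gauge upper bound (`Q_n` is the infimum),
and the zero case: the infimum is attained at some gauge `k`, a vanishing sum of non-negative terms
forces every valid term to vanish, and `‖½(ρ(v) − ρ(v)ᴴ)‖²_F = 0` gives `ρ(v) = ρ(v)ᴴ = ρ(v⁻¹)`,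
hence `v = v⁻¹` by faithfulness, i.e. `v * v = 1`.

This is the `n`-cube version of `CentralInvolutions.exists_plaquetteOrbitFunctional`
(file `…FloorCentralInvolutionsOrbit.lean`), with NO hypothesis on the involutions of `G`.
Elementary; no named facts are used.
-/

set_option autoImplicit false

open scoped BigOperators Topology Matrix
open Filter MeasureTheory ProbabilityTheory
open Literature.MathematicalPhysics.QuantumFieldTheory
open Summit.QuantumFields.YangMills.Cruxes.CovarianceBound.SupportWindow
  (froSq coulombF IsCoulMin gluon modeCov supCov wilson4)

noncomputable section

namespace Summit.QuantumFields.YangMills.Theorems.BrascampLiebVacuumSC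

open Summit.QuantumFields.YangMills.Cruxes.CovarianceBound.SupportWindow.SupMeasurable

/-- **Stub (COMPACTNESS/ALGEBRA — the cube orbit functional, `stub_cubeOrbit`).** For a faithful unitary `r`
of a compact `G` and `n : ℕ` there is a continuous `Q_n : (cube configurations) → [0, 3n³N]`, depending only
on the values on the links `(x, j)` with `x j + 1 < n`, with (any-gauge bound) `Q_n(u) ≤ Σ_{links} ‖½(ρv −
ρvᴴ)‖²_F`, `v = k(x) u(x,j) k(x+e_j)⁻¹`, for EVERY cube gauge `k`, and (zero set) `Q_n(u) = 0 ⇒` some gauge `k`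
makes every link value an involution. Construction: `Q_n(u) = inf_k` of the right-hand side (continuous by
compactness of `G^{cube}`, infimum attained; a unitary with vanishing anti-Hermitian part squares to `1`, and
`r` is injective). The `n`-cube version of `exists_plaquetteOrbitFunctional`, with no hypothesis on the
involutions of `G`. [folklore] -/
theorem stub_cubeOrbit :
    ∀ (G : Type) [Group G] [TopologicalSpace G] [IsTopologicalGroup G] [CompactSpace G]
    (r : LatticeRep G) (n : ℕ),
    ∃ Q : ((Fin 3 → Fin n) → Fin 3 → G) → ℝ,
      Continuous Q ∧ (∀ u, 0 ≤ Q u) ∧ (∀ u, Q u ≤ 3 * (n : ℝ) ^ 3 * r.N) ∧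
      (∀ u u' : (Fin 3 → Fin n) → Fin 3 → G,
        (∀ (x : Fin 3 → Fin n) (j : Fin 3), (x j : ℕ) + 1 < n → u x j = u' x j) → Q u = Q u') ∧
      (∀ (k : (Fin 3 → Fin n) → G) (u : (Fin 3 → Fin n) → Fin 3 → G),
        Q u ≤ ∑ x : Fin 3 → Fin n, ∑ j : Fin 3,
          if h : (x j : ℕ) + 1 < n then
            froSq ((1 / 2 : ℂ) • (r.ρ (k x * u x j * (k (Function.update x j ⟨(x j : ℕ) + 1, h⟩))⁻¹) -
              (r.ρ (k x * u x j * (k (Function.update x j ⟨(x j : ℕ) + 1, h⟩))⁻¹))ᴴ))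
          else 0) ∧
      (∀ u : (Fin 3 → Fin n) → Fin 3 → G, Q u = 0 →
        ∃ k : (Fin 3 → Fin n) → G, ∀ (x : Fin 3 → Fin n) (j : Fin 3) (h : (x j : ℕ) + 1 < n),
          k x * u x j * (k (Function.update x j ⟨(x j : ℕ) + 1, h⟩))⁻¹ *
            (k x * u x j * (k (Function.update x j ⟨(x j : ℕ) + 1, h⟩))⁻¹) = 1) := by
  intro G _ _ _ _ r n
  classical
  -- the anti-Hermitian mass of a link value (an opaque local function with its equation)
  -- adapted from `CentralInvolutions.exists_plaquetteOrbitFunctional`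
  obtain ⟨asq, hasq⟩ : ∃ asq : G → ℝ, asq = fun g => froSq ((1 / 2 : ℂ) • (r.ρ g - (r.ρ g)ᴴ)) :=
    ⟨_, rfl⟩
  have hasq0 : ∀ g, 0 ≤ asq g := fun g => by rw [hasq]; exact froSq_nonneg _
  have hasqc : Continuous asq := by
    rw [hasq]
    exact continuous_froSq.comp
      ((r.continuous.fun_sub r.continuous.matrix_conjTranspose).fun_const_smul (1 / 2 : ℂ))
  have hasqN : ∀ g, asq g ≤ r.N := fun g => by
    rw [hasq]
    exact (froSq_half_sub_conjTranspose_le _).trans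
      (froSq_of_mem_unitaryGroup (r.mem_unitary _)).le
  have hasq_zero : ∀ g, asq g = 0 → g * g = 1 := by
    intro g hg
    rw [hasq] at hg
    have hM : (1 / 2 : ℂ) • (r.ρ g - (r.ρ g)ᴴ) = 0 := by
      ext a b
      have h1 : ∑ a', ∑ b', ‖((1 / 2 : ℂ) • (r.ρ g - (r.ρ g)ᴴ)) a' b'‖ ^ 2 = 0 := hg
      have h2 := (Finset.sum_eq_zero_iff_of_nonneg (fun a' _ =>
        Finset.sum_nonneg fun b' _ => sq_nonneg _)).1 h1 a (Finset.mem_univ a)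
      have h3 := (Finset.sum_eq_zero_iff_of_nonneg (fun b' _ => sq_nonneg _)).1 h2 b
        (Finset.mem_univ b)
      simpa using h3
    have hsub : r.ρ g - (r.ρ g)ᴴ = 0 := by
      rcases smul_eq_zero.1 hM with h | h
      · norm_num at h
      · exact h
    have hinv : r.ρ g = r.ρ g⁻¹ := by
      rw [GaugeAlgebra.map_inv_eq_conjTranspose]; exact sub_eq_zero.1 hsub
    have hg' : g = g⁻¹ := r.injective hinv
    exact mul_eq_one_iff_eq_inv.2 hg'
  -- the total mass of the cube in the gauge `k` and the orbit functional (opaque)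
  obtain ⟨ψ, hψ⟩ : ∃ ψ : ((Fin 3 → Fin n) → G) → ((Fin 3 → Fin n) → Fin 3 → G) → ℝ,
      ψ = fun k u => ∑ x : Fin 3 → Fin n, ∑ j : Fin 3,
        if h : (x j : ℕ) + 1 < n then
          asq (k x * u x j * (k (Function.update x j ⟨(x j : ℕ) + 1, h⟩))⁻¹) else 0 := ⟨_, rfl⟩
  obtain ⟨Q, hQ⟩ : ∃ Q : ((Fin 3 → Fin n) → Fin 3 → G) → ℝ, Q = fun u => ⨅ k, ψ k u := ⟨_, rfl⟩
  -- termwise facts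
  have hterm0 : ∀ (k : (Fin 3 → Fin n) → G) (u : (Fin 3 → Fin n) → Fin 3 → G)
      (x : Fin 3 → Fin n) (j : Fin 3),
      0 ≤ (if h : (x j : ℕ) + 1 < n then
        asq (k x * u x j * (k (Function.update x j ⟨(x j : ℕ) + 1, h⟩))⁻¹) else 0 : ℝ) := by
    intro k u x j
    by_cases h : (x j : ℕ) + 1 < n
    · simp only [dif_pos h]; exact hasq0 _
    · simp only [dif_neg h]; exact le_rfl
  have htermN : ∀ (k : (Fin 3 → Fin n) → G) (u : (Fin 3 → Fin n) → Fin 3 → G)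
      (x : Fin 3 → Fin n) (j : Fin 3),
      (if h : (x j : ℕ) + 1 < n then
        asq (k x * u x j * (k (Function.update x j ⟨(x j : ℕ) + 1, h⟩))⁻¹) else 0 : ℝ) ≤ r.N := by
    intro k u x j
    by_cases h : (x j : ℕ) + 1 < n
    · simp only [dif_pos h]; exact hasqN _
    · simp only [dif_neg h]; exact Nat.cast_nonneg _
  -- joint continuity of `(k, u) ↦ ψ k u`
  have hψc : Continuous fun q : ((Fin 3 → Fin n) → G) × ((Fin 3 → Fin n) → Fin 3 → G) =>
      ψ q.1 q.2 := by
    rw [hψ]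
    refine continuous_finsetSum _ fun x _ => continuous_finsetSum _ fun j _ => ?_
    by_cases h : (x j : ℕ) + 1 < n
    · simp only [dif_pos h]
      refine hasqc.comp ((Continuous.mul (Continuous.mul ?_ ?_)) (Continuous.inv ?_))
      · exact (continuous_apply x).comp continuous_fst
      · exact (continuous_apply j).comp ((continuous_apply x).comp continuous_snd)
      · exact (continuous_apply _).comp continuous_fst
    · simp only [dif_neg h]
      exact continuous_const
  have hψ0 : ∀ k u, 0 ≤ ψ k u := fun k u => by
    rw [hψ]
    exact Finset.sum_nonneg fun x _ => Finset.sum_nonneg fun j _ => hterm0 k u x j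
  have hψN : ∀ k u, ψ k u ≤ 3 * (n : ℝ) ^ 3 * r.N := fun k u => by
    rw [hψ]
    refine (Finset.sum_le_sum fun x _ => Finset.sum_le_sum fun j _ => htermN k u x j).trans
      (le_of_eq ?_)
    simp only [Finset.sum_const, Finset.card_univ, Fintype.card_fun, Fintype.card_fin,
      nsmul_eq_mul]
    push_cast
    ring
  have hψdep : ∀ (k : (Fin 3 → Fin n) → G) (u u' : (Fin 3 → Fin n) → Fin 3 → G),
      (∀ (x : Fin 3 → Fin n) (j : Fin 3), (x j : ℕ) + 1 < n → u x j = u' x j) →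
      ψ k u = ψ k u' := by
    intro k u u' huu'
    rw [hψ]
    refine Finset.sum_congr rfl fun x _ => Finset.sum_congr rfl fun j _ => ?_
    by_cases h : (x j : ℕ) + 1 < n
    · simp only [dif_pos h, huu' x j h]
    · simp only [dif_neg h]
  have hbdd : ∀ u, BddBelow (Set.range fun k => ψ k u) := fun u =>
    ⟨0, by rintro _ ⟨k, rfl⟩; exact hψ0 k u⟩
  have hQle : ∀ k u, Q u ≤ ψ k u := fun k u => by rw [hQ]; exact ciInf_le (hbdd u) k
  have hQ0 : ∀ u, 0 ≤ Q u := fun u => by rw [hQ]; exact le_ciInf fun k => hψ0 k u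
  have hQN : ∀ u, Q u ≤ 3 * (n : ℝ) ^ 3 * r.N := fun u => (hQle 1 u).trans (hψN 1 u)
  -- continuity (Berge / compactness)
  have hQc : Continuous Q := by
    have hQ' : Q = fun u => sInf ((fun k => ψ k u) '' Set.univ) := by
      rw [hQ]; funext u; rw [Set.image_univ, sInf_range]
    rw [hQ']
    exact IsCompact.continuous_sInf (f := fun u k => ψ k u) isCompact_univ
      (hψc.comp (continuous_snd.prodMk continuous_fst))
  refine ⟨Q, hQc, hQ0, hQN, fun u u' huu' => ?_, fun k u => ?_, fun u hQu => ?_⟩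
  · -- dependence on the valid entries only
    rw [hQ]
    exact iInf_congr fun k => hψdep k u u' huu'
  · -- the any-gauge bound
    have h := hQle k u
    rw [hψ, hasq] at h
    exact h
  · -- the zero case: the infimum is attained, and every valid term vanishes there
    have hcont : Continuous fun k => ψ k u :=
      hψc.comp (continuous_id.prodMk continuous_const)
    obtain ⟨k, -, hk⟩ := isCompact_univ.exists_isMinOn Set.univ_nonempty hcont.continuousOn
    have hkQ : ψ k u = 0 := by
      refine le_antisymm ?_ (hψ0 _ _)
      have h2 : ψ k u ≤ Q u := by
        rw [hQ]
        exact le_ciInf fun k' => hk (Set.mem_univ k')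
      linarith
    refine ⟨k, fun x j h => hasq_zero _ ?_⟩
    rw [hψ] at hkQ
    have h1 := (Finset.sum_eq_zero_iff_of_nonneg (fun x' _ =>
      Finset.sum_nonneg fun j' _ => hterm0 k u x' j')).1 hkQ x (Finset.mem_univ x)
    have h2 := (Finset.sum_eq_zero_iff_of_nonneg (fun j' _ => hterm0 k u x j')).1 h1 j
      (Finset.mem_univ j)
    simp only [dif_pos h] at h2
    exact h2

end Summit.QuantumFields.YangMills.Theorems.BrascampLiebVacuumSC

end
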